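import Literature.AnabelianGeometry.SemiGraphs.PSCThreeChainShape
import Literature.AnabelianGeometry.SemiGraphs.PSCSeparatingCoveringsCrossVertex
import HarnessLib

/-!
# [CombGC] Prop. 1.2, proof p. 9: VERTICIAL separating coverings at THREE-COMPONENT CHAINS pointed on every component (row F-2826)

Mochizuki, *A combinatorial version of the Grothendieck conjecture*, Tohoku Math. J. **59** (2007)
[CombGC], PROOF of Proposition 1.2, p. 9: "if `v₁ ≠ v₂` …, then there exists a finite étale … covering
`G' → G` whose restriction to the anabelioid `G_{v₂}` is trivial …, but whose restriction to `G_{v₁}` is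
nontrivial" [cite: MochizukiCombGC2007, Prop 1.2 proof p.9]; typed LEVEL-WISE as
`PSCDatum.VerticialSeparatingCoverings` (abc-iut-w4-d081, row P12-L01-V; abc-iut FACT-LIST row F-2826, the
verticial conjunct of F-2829 / F-2830 — a schema whose universal closure is refuted as typed; the instance
forms at genuine carriers are the content).

PROOF-ONLY file (abc-iut-f-166 gen 6, row «ONE-CUSP-CORNERS» (7); 0 definitions).  The carrier: abc-iut-f-164's
THREE-COMPONENT CHAIN shape (`PSCThreeChainShape.lean`: `C₀ ∪_{ν_A} C_mid ∪_{ν_B} C₁`, node loops `ε_A`, `η`,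
marked points `c_j` on `C₁` for `j < s₁`, on `C_mid` for `s₁ ≤ j < s₂`, on `C₀` for `s₂ ≤ j`; `ι : Γ_{g,r} → Π`
a profinite pro-`Σ` completion) with the cusp conditions RELAXED from `2 ≤ s₁`, `s₁ + 2 ≤ s₂`, `s₂ + 2 ≤ r`
(`PSCSeparatingCoveringsThreeChain.lean`) to `1 ≤ s₁ < s₂ < r` plus the stability of the two end
components (`1 ≤ g₀ ∨ 2 ≤ r − s₂`, `1 ≤ g − g₁ ∨ 2 ≤ s₁`; the middle component carries two nodes) — so every
component may carry a SINGLE marked point.  The chain basis `B` with both loops as members exists in that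
range (`exists_freeGroupBasis_nodeLoop` + `exists_freeGroupBasis_insert_nodeLoop`; packaged here as
`exists_chainBasis`), the three vertex groups are sub-basis closures of it (`closure_chainFirst_eq`,
`closure_chainMid_eq`, `closure_chainLast_eq` carry exactly these bounds), and gen 3's engine
`verticialSeparatingCoverings_of_freeFactors'` applies; the cross-vertex witnesses are the loops `ε_A`, `η`
themselves and, at the two ends, a handle or second marked point supplied by stability.

* `exists_chainBasis` — the chain basis for `1 ≤ s₁ < s₂ ≤ r'` (abc-iut-f-164's `exists_chainBases` minus
  its three auxiliary cusp bases, which need the spare marked points);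
* `verticialSeparatingCoverings_of_threeChain'` — **F-2826** (`V' := V`) at EVERY pointed three-chain datum.

Instance forms at data of the shape of genuine stable curves: consistency evidence for the typed schema, not
the printed theorem for all pointed stable curves.  Nothing here takes a side on [IUTchIII] Cor. 3.12.
-/

noncomputable section

/-! ### The chain basis for `1 ≤ s₁ < s₂ ≤ r'` -/

namespace Literature.GroupTheory.CombinatorialGroupTheory.PuncturedSurfaceGroup

variable {g r' g₀ g₁ s₁ s₂ : ℕ}

/-- **The chain basis** of `Γ_{g,r'+1}` for `1 ≤ s₁ < s₂ ≤ r'`: a free basis `B` whose handle members are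
`a_i`, `b_i`, whose cusp members off the slots `s₁ − 1`, `s₂ − 1` are `c_{j+1}`, and which carries the node
loops `η` at slot `s₁ − 1` and `ε_A` at slot `s₂ − 1` (node-loop basis of `η`, then the Nielsen move
`c_{s₂} ↦ ε_A`). [cite: LyndonSchupp2001, I.3 Prop 3.8] -/
theorem exists_chainBasis (εA η : PuncturedSurfaceGroup g (r' + 1))
    (hεA : εA = ((List.finRange (r' + 1)).map fun j : Fin (r' + 1) =>
        if s₂ ≤ (j : ℕ) then c (g := g) j else 1).prod *
      ((List.finRange g).map fun i : Fin g => if (i : ℕ) < g₀ then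
        a (r := r' + 1) i * b i * (a i)⁻¹ * (b i)⁻¹ else 1).prod)
    (hη : η = ((List.finRange (r' + 1)).map fun j : Fin (r' + 1) =>
        if s₁ ≤ (j : ℕ) then c (g := g) j else 1).prod *
      ((List.finRange g).map fun i : Fin g => if (i : ℕ) < g₁ then
        a (r := r' + 1) i * b i * (a i)⁻¹ * (b i)⁻¹ else 1).prod)
    (hs1 : 1 ≤ s₁) (hs : s₁ < s₂) (hsr : s₂ ≤ r') :
    ∃ B : FreeGroupBasis ((Fin g × Bool) ⊕ Fin r') (PuncturedSurfaceGroup g (r' + 1)),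
      (∀ i, B (Sum.inl (i, false)) = a i) ∧ (∀ i, B (Sum.inl (i, true)) = b i) ∧
      (∀ j : Fin r', (j : ℕ) + 1 ≠ s₁ → (j : ℕ) + 1 ≠ s₂ → B (Sum.inr j) = c (Fin.succ j)) ∧
      (∀ h : s₂ - 1 < r', B (Sum.inr ⟨s₂ - 1, h⟩) = εA) ∧ (∀ h : s₁ - 1 < r', B (Sum.inr ⟨s₁ - 1, h⟩) = η) := by
  classical
  obtain ⟨bB, haB, hbB, hcB, hkB⟩ := exists_freeGroupBasis_nodeLoop g r' g₁ s₁ hs1 (by omega) η hη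
  have hBκ : bB (Sum.inr ⟨s₂ - 1, by omega⟩) = c ⟨s₂, by omega⟩ := by
    rw [hcB _ (by simp only; omega)]; congr 1; ext; simp only [Fin.val_succ]; omega
  obtain ⟨B, hBA, hB⟩ := exists_freeGroupBasis_insert_nodeLoop hεA haB hbB (by omega) hsr hBκ
    (fun j hj => hcB j (by omega))
  refine ⟨B, fun i => by rw [hB _ (by simp), haB], fun i => by rw [hB _ (by simp), hbB],
    fun j hj1 hj2 => ?_, fun _ => hBA, fun h => ?_⟩
  · rw [hB _ (by simp only [Ne, Sum.inr.injEq, Fin.ext_iff]; omega), hcB j hj1]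
  · rw [hB _ (by simp only [Ne, Sum.inr.injEq, Fin.ext_iff]; omega), hkB]

end Literature.GroupTheory.CombinatorialGroupTheory.PuncturedSurfaceGroup

namespace Literature.AnabelianGeometry.SemiGraphs

namespace PSCDatum

open scoped Pointwise
open Literature.GroupTheory.CombinatorialGroupTheory
open Literature.GroupTheory.CombinatorialGroupTheory.PuncturedSurfaceGroup (a b c cuspInertia
  exists_chainBasis closure_chainFirst_eq closure_chainLast_eq closure_chainMid_eq)
open SemiGraphOfAnabelioids (IsProSigmaCompletion)

variable {P : Type} [Group P] [TopologicalSpace P] [IsTopologicalGroup P]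
variable [CompactSpace P] [TotallyDisconnectedSpace P] {Sigma : Set ℕ} {g r : ℕ}

/-- **Row P12-L01-V / F-2826 (`VerticialSeparatingCoverings`, `V' := V`) at EVERY three-component chain
datum pointed on every component** (`1 ≤ s₁ < s₂ < r`, end components stable, any genera): ONE chain basis
for all three vertices; two level vertices over the same vertex are separated by the fibred twist, over
different vertices by the projection killing the other factor — witnesses: the loops `ε_A` (alive `C₀` or
`C_mid`), `η` (alive `C_mid` or `C₁`), and at the ends a handle or a second marked point.
[cite: MochizukiCombGC2007, Prop 1.2 proof p.9] -/
theorem verticialSeparatingCoverings_of_threeChain' (hne : Sigma.Nonempty)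
    (hprime : ∀ p ∈ Sigma, p.Prime) (ι : PuncturedSurfaceGroup g r →* P)
    (hι : IsProSigmaCompletion Sigma ι) (G : PSCDatum P) {g₀ g₁ s₁ s₂ : ℕ} (hg : g₀ ≤ g₁) (hg₁ : g₁ ≤ g)
    (hs₁ : 1 ≤ s₁) (hs₁₂ : s₁ < s₂) (hs₂ : s₂ < r) (hst₀ : 1 ≤ g₀ ∨ 2 ≤ r - s₂) (hst₁ : 1 ≤ g - g₁ ∨ 2 ≤ s₁)
    (v₀ vm v₁ : G.graph.V) (hV : ∀ w, w = v₀ ∨ w = vm ∨ w = v₁) (εA η : PuncturedSurfaceGroup g r)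
    (hεA : εA = ((List.finRange r).map fun j : Fin r =>
          if s₂ ≤ (j : ℕ) then PuncturedSurfaceGroup.c (g := g) j else 1).prod *
        ((List.finRange g).map fun i : Fin g => if (i : ℕ) < g₀ then
          PuncturedSurfaceGroup.a (r := r) i * PuncturedSurfaceGroup.b i *
            (PuncturedSurfaceGroup.a i)⁻¹ * (PuncturedSurfaceGroup.b i)⁻¹ else 1).prod)
    (hη : η = ((List.finRange r).map fun j : Fin r =>
          if s₁ ≤ (j : ℕ) then PuncturedSurfaceGroup.c (g := g) j else 1).prod *
        ((List.finRange g).map fun i : Fin g => if (i : ℕ) < g₁ then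
          PuncturedSurfaceGroup.a (r := r) i * PuncturedSurfaceGroup.b i *
            (PuncturedSurfaceGroup.a i)⁻¹ * (PuncturedSurfaceGroup.b i)⁻¹ else 1).prod)
    (hV₀ : G.vertGp v₀ = ((Subgroup.closure {x : PuncturedSurfaceGroup g r |
        (∃ i : Fin g, (i : ℕ) < g₀ ∧ (x = PuncturedSurfaceGroup.a i ∨ x = PuncturedSurfaceGroup.b i)) ∨
        ∃ j : Fin r, s₂ ≤ (j : ℕ) ∧ x = PuncturedSurfaceGroup.c j}).map ι).topologicalClosure)
    (hVm : G.vertGp vm = ((Subgroup.closure {x : PuncturedSurfaceGroup g r |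
        (∃ i : Fin g, (g₀ ≤ (i : ℕ) ∧ (i : ℕ) < g₁) ∧
          (x = PuncturedSurfaceGroup.a i ∨ x = PuncturedSurfaceGroup.b i)) ∨
        (∃ j : Fin r, (s₁ ≤ (j : ℕ) ∧ (j : ℕ) < s₂) ∧ x = PuncturedSurfaceGroup.c j) ∨
        x = εA ∨ x = η}).map ι).topologicalClosure)
    (hV₁ : G.vertGp v₁ = ((Subgroup.closure {x : PuncturedSurfaceGroup g r |
        (∃ i : Fin g, g₁ ≤ (i : ℕ) ∧ (x = PuncturedSurfaceGroup.a i ∨ x = PuncturedSurfaceGroup.b i)) ∨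
        (∃ j : Fin r, (j : ℕ) < s₁ ∧ x = PuncturedSurfaceGroup.c j) ∨ x = η}).map ι).topologicalClosure) :
    G.VerticialSeparatingCoverings := by
  classical
  obtain ⟨r', rfl⟩ : ∃ r', r = r' + 1 := ⟨r - 1, by omega⟩
  have hp : ∃ p ∈ Sigma, p.Prime := hne.imp fun p hp => ⟨hp, hprime p hp⟩
  -- the chain basis and the three index sets
  obtain ⟨B, ha, hb, hc, hA, hBη⟩ := exists_chainBasis εA η hεA hη hs₁ hs₁₂ (by omega)
  set S₀ : Set ((Fin g × Bool) ⊕ Fin r') :=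
    {x | Sum.elim (fun p : Fin g × Bool => (p.1 : ℕ) < g₀) (fun j : Fin r' => s₂ ≤ (j : ℕ) + 1) x} with hS₀
  set Sm : Set ((Fin g × Bool) ⊕ Fin r') :=
    {x | Sum.elim (fun p : Fin g × Bool => g₀ ≤ (p.1 : ℕ) ∧ (p.1 : ℕ) < g₁)
      (fun j : Fin r' => s₁ ≤ (j : ℕ) + 1 ∧ (j : ℕ) + 1 ≤ s₂) x} with hSm
  set S₁ : Set ((Fin g × Bool) ⊕ Fin r') :=
    {x | Sum.elim (fun p : Fin g × Bool => g₁ ≤ (p.1 : ℕ)) (fun j : Fin r' => (j : ℕ) + 1 ≤ s₁) x} with hS₁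
  have h0l : ∀ p : Fin g × Bool, (Sum.inl p : (Fin g × Bool) ⊕ Fin r') ∈ S₀ ↔ (p.1 : ℕ) < g₀ := fun _ => Iff.rfl
  have hml : ∀ p : Fin g × Bool, (Sum.inl p : (Fin g × Bool) ⊕ Fin r') ∈ Sm ↔
      g₀ ≤ (p.1 : ℕ) ∧ (p.1 : ℕ) < g₁ := fun _ => Iff.rfl
  have h1l : ∀ p : Fin g × Bool, (Sum.inl p : (Fin g × Bool) ⊕ Fin r') ∈ S₁ ↔ g₁ ≤ (p.1 : ℕ) := fun _ => Iff.rfl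
  have h0r : ∀ j : Fin r', (Sum.inr j : (Fin g × Bool) ⊕ Fin r') ∈ S₀ ↔ s₂ ≤ (j : ℕ) + 1 := fun _ => Iff.rfl
  have hmr : ∀ j : Fin r', (Sum.inr j : (Fin g × Bool) ⊕ Fin r') ∈ Sm ↔
      s₁ ≤ (j : ℕ) + 1 ∧ (j : ℕ) + 1 ≤ s₂ := fun _ => Iff.rfl
  have h1r : ∀ j : Fin r', (Sum.inr j : (Fin g × Bool) ⊕ Fin r') ∈ S₁ ↔ (j : ℕ) + 1 ≤ s₁ := fun _ => Iff.rfl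
  -- the loop slots: `τA = s₂ − 1` (in `S₀ ∩ Sm`, not in `S₁`), `τB = s₁ − 1` (in `Sm ∩ S₁`, not in `S₀`)
  set τA : (Fin g × Bool) ⊕ Fin r' := Sum.inr ⟨s₂ - 1, by omega⟩ with hτA
  set τB : (Fin g × Bool) ⊕ Fin r' := Sum.inr ⟨s₁ - 1, by omega⟩ with hτB
  have hτA0 : τA ∈ S₀ := (h0r _).mpr (by simp only; omega)
  have hτAm : τA ∈ Sm := (hmr _).mpr ⟨by simp only; omega, by simp only; omega⟩
  have hτA1 : τA ∉ S₁ := fun h => by have := (h1r _).mp h; simp only at this; omega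
  have hτBm : τB ∈ Sm := (hmr _).mpr ⟨by simp only; omega, by simp only; omega⟩
  have hτB1 : τB ∈ S₁ := (h1r _).mpr (by simp only; omega)
  have hτB0 : τB ∉ S₀ := fun h => by have := (h0r _).mp h; simp only at this; omega
  -- the end witnesses: a letter of `S₀ ∖ Sm` and one of `S₁ ∖ Sm` (stability of `C₀`, `C₁`)
  obtain ⟨x₀, hx₀0, hx₀m⟩ : ∃ x, x ∈ S₀ ∧ x ∉ Sm := by
    rcases hst₀ with h | h
    · exact ⟨Sum.inl (⟨0, by omega⟩, false), (h0l _).mpr (by simp only; omega),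
        fun h' => by have := (hml _).mp h'; simp only at this; omega⟩
    · exact ⟨Sum.inr ⟨s₂, by omega⟩, (h0r _).mpr (by simp only; omega),
        fun h' => by have := (hmr _).mp h'; simp only at this; omega⟩
  obtain ⟨x₁, hx₁1, hx₁m⟩ : ∃ x, x ∈ S₁ ∧ x ∉ Sm := by
    rcases hst₁ with h | h
    · exact ⟨Sum.inl (⟨g₁, by omega⟩, false), (h1l _).mpr (by simp only; exact le_rfl),
        fun h' => by have := (hml _).mp h'; simp only at this; omega⟩
    · exact ⟨Sum.inr ⟨0, by omega⟩, (h1r _).mpr (by simp only; omega),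
        fun h' => by have := (hmr _).mp h'; simp only at this; omega⟩
  -- the vertex groups as sub-basis closures of `B`
  have hA₀ : G.vertGp v₀ = ((Subgroup.closure (B '' S₀)).map ι).topologicalClosure := by
    rw [hV₀, closure_chainFirst_eq hεA ha hb hc hA (by omega) (by omega)]
  have hAm : G.vertGp vm = ((Subgroup.closure (B '' Sm)).map ι).topologicalClosure := by
    rw [hVm, closure_chainMid_eq hεA hη ha hb hc hA hBη hg (by omega) (by omega) (by omega)]
  have hA₁ : G.vertGp v₁ = ((Subgroup.closure (B '' S₁)).map ι).topologicalClosure := by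
    rw [hV₁, closure_chainLast_eq hη ha hb hc hBη (by omega) (by omega) (by omega)]
  -- the index set of a vertex (no distinctness of `v₀, vm, v₁` is assumed: equal vertices have equal groups)
  let Ss : G.graph.V → Set ((Fin g × Bool) ⊕ Fin r') := fun v =>
    if v = v₀ then S₀ else if v = vm then Sm else S₁
  have hS0 : Ss v₀ = S₀ := by
    show (if v₀ = v₀ then S₀ else if v₀ = vm then Sm else S₁) = S₀
    rw [if_pos rfl]
  have hSm' : vm ≠ v₀ → Ss vm = Sm := fun h => by
    show (if vm = v₀ then S₀ else if vm = vm then Sm else S₁) = Sm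
    rw [if_neg h, if_pos rfl]
  have hS1 : v₁ ≠ v₀ → v₁ ≠ vm → Ss v₁ = S₁ := fun h h' => by
    show (if v₁ = v₀ then S₀ else if v₁ = vm then Sm else S₁) = S₁
    rw [if_neg h, if_neg h']
  have hv : ∀ v, G.vertGp v = ((Subgroup.closure (B '' Ss v)).map ι).topologicalClosure := by
    intro v
    rcases hV v with rfl | rfl | rfl
    · rw [hS0]; exact hA₀
    · by_cases h : v = v₀
      · subst h; rw [hS0]; exact hA₀
      · rw [hSm' h]; exact hAm
    · by_cases h : v = v₀
      · subst h; rw [hS0]; exact hA₀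
      · by_cases h' : v = vm
        · subst h'; rw [hSm' h]; exact hAm
        · rw [hS1 h h']; exact hA₁
  have hSsne : ∀ v, (Ss v).Nonempty := by
    intro v
    rcases hV v with rfl | rfl | rfl
    · rw [hS0]; exact ⟨τA, hτA0⟩
    · by_cases h : v = v₀
      · subst h; rw [hS0]; exact ⟨τA, hτA0⟩
      · rw [hSm' h]; exact ⟨τA, hτAm⟩
    · by_cases h : v = v₀
      · subst h; rw [hS0]; exact ⟨τA, hτA0⟩
      · by_cases h' : v = vm
        · subst h'; rw [hSm' h]; exact ⟨τA, hτAm⟩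
        · rw [hS1 h h']; exact ⟨τB, hτB1⟩
  -- the projections killing `B(S_v)`
  let ρs : G.graph.V → (PuncturedSurfaceGroup g (r' + 1) →* PuncturedSurfaceGroup g (r' + 1)) := fun v =>
    B.lift fun j => if j ∈ Ss v then 1 else B j
  have hρs : ∀ v j, ρs v (B j) = if j ∈ Ss v then 1 else B j := fun v j => B.lift_apply_basis _ j
  have hcl : ∀ (S : Set ((Fin g × Bool) ⊕ Fin r')) (j : (Fin g × Bool) ⊕ Fin r'), j ∈ S →
      ι (B j) ∈ ((Subgroup.closure (B '' S)).map ι).topologicalClosure := fun S j hj =>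
    Subgroup.le_topologicalClosure _ (Subgroup.mem_map_of_mem ι (Subgroup.subset_closure ⟨j, hj, rfl⟩))
  have hmem0 : ∀ j, j ∈ S₀ → ι (B j) ∈ G.vertGp v₀ := fun j hj => by rw [hA₀]; exact hcl S₀ j hj
  have hmemm : ∀ j, j ∈ Sm → ι (B j) ∈ G.vertGp vm := fun j hj => by rw [hAm]; exact hcl Sm j hj
  have hmem1 : ∀ j, j ∈ S₁ → ι (B j) ∈ G.vertGp v₁ := fun j hj => by rw [hA₁]; exact hcl S₁ j hj
  have hfix : ∀ (v : G.graph.V) (j : (Fin g × Bool) ⊕ Fin r'), j ∉ Ss v → ρs v (B j) ≠ 1 := by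
    intro v j hj
    rw [hρs v j, if_neg hj]
    exact FreeGroupBasis.apply_ne_one _ _
  -- cross-vertex witnesses, by the index set of the killed vertex
  have hsep : ∀ w₁ w₂ : G.graph.V, w₁ ≠ w₂ → ∃ x : PuncturedSurfaceGroup g (r' + 1),
      ι x ∈ G.vertGp w₁ ∧ ρs w₂ x ≠ 1 := by
    intro w₁ w₂ h12
    by_cases h2 : w₂ = v₀
    · -- killed `v₀` (`S₀`): the loop `η` survives, alive `C_mid` or `C₁`
      rw [h2] at h12 ⊢
      rcases hV w₁ with h1 | h1 | h1
      · exact absurd h1 h12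
      · exact ⟨B τB, by rw [h1]; exact hmemm τB hτBm, hfix v₀ τB (by rw [hS0]; exact hτB0)⟩
      · exact ⟨B τB, by rw [h1]; exact hmem1 τB hτB1, hfix v₀ τB (by rw [hS0]; exact hτB0)⟩
    · by_cases h2' : w₂ = vm
      · -- killed `C_mid` (`Sm`): an end letter survives (stability), alive `C₀` or `C₁`
        rw [h2'] at h12 h2 ⊢
        rcases hV w₁ with h1 | h1 | h1
        · exact ⟨B x₀, by rw [h1]; exact hmem0 x₀ hx₀0, hfix vm x₀ (by rw [hSm' h2]; exact hx₀m)⟩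
        · exact absurd h1 h12
        · exact ⟨B x₁, by rw [h1]; exact hmem1 x₁ hx₁1, hfix vm x₁ (by rw [hSm' h2]; exact hx₁m)⟩
      · -- killed `C₁` (`S₁`): the loop `ε_A` survives, alive `C₀` or `C_mid`
        have hw₂ : w₂ = v₁ := by
          rcases hV w₂ with h | h | h
          · exact absurd h h2
          · exact absurd h h2'
          · exact h
        rw [hw₂] at h12 h2 h2' ⊢
        rcases hV w₁ with h1 | h1 | h1
        · exact ⟨B τA, by rw [h1]; exact hmem0 τA hτA0, hfix v₁ τA (by rw [hS1 h2 h2']; exact hτA1)⟩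
        · exact ⟨B τA, by rw [h1]; exact hmemm τA hτAm, hfix v₁ τA (by rw [hS1 h2 h2']; exact hτA1)⟩
        · exact absurd h1 h12
  exact G.verticialSeparatingCoverings_of_freeFactors' hι hp (fun _ => B) Ss hSsne hv ρs hρs hsep

end PSCDatum

end Literature.AnabelianGeometry.SemiGraphs

end
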